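import Mathlib.RingTheory.PowerSeries.Exp
import Mathlib.RingTheory.PowerSeries.Trunc
import Mathlib.LinearAlgebra.Lagrange
import Mathlib.FieldTheory.IsAlgClosed.Basic
import Mathlib.Analysis.Complex.Polynomial.Basic
import Literature.Computability.AlgebraicComplexity.DepthThreeChasm
import Literature.Computability.AlgebraicComplexity.DepthThreeChasmCircuits
import Literature.Computability.AlgebraicComplexity.DepthReductionProofs
import Literature.Computability.AlgebraicComplexity.PolarizationIdentity

/-!
# The chasm at depth three — discharge of `sigmaPiSigma_edgeSize_le_of_complexity`

Discharge (D-0014) of the named fact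
`Literature.Computability.AlgebraicComplexity.sigmaPiSigma_edgeSize_le_of_complexity`
(`DepthThreeChasm.lean`: Tavenas, *Improved bounds for reduction to depth 4 and depth 3*,
Inform. and Comput. 240 (2015), **Cor. 1**, sharpening Gupta–Kamath–Kayal–Saptharishi, *Arithmetic
circuits: a chasm at depth three*, SIAM J. Comput. 45 (2016) = ECCC TR13-026, **Thm. 1.1**):
for every exponent `a` there is `K` (here `K = 100 a + 600`, `chasmConst`) such that every
`f ∈ ℂ[x₁,…,xₙ]` with `deg f ≤ d ≤ n^a + a` and fan-in-two complexity `≤ s` is computed by a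
circuit of product-depth `≤ 1` (a `ΣΠΣ` circuit) with at most
`2 ^ (K ⌊√(d (log₂ n + 1)(log₂ s + 1))⌋ + K)` wires:
`Literature.Computability.AlgebraicComplexity.sigmaPiSigma_edgeSize_le_of_complexity_holds`
(end of file), from `DepthThree.exists_sigmaPiSigma`.

## The printed proof and what is reused

GKKS prove Thm. 1.1 in three steps (TR13-026 §2 "Proof overview", §4; the lemma numbers below
are those of TR13-026): (1) reduction to depth four, `ΣΠ^{[a]}ΣΠ^{[d/a]}` circuits (their
Thm. 4.1 = Koiran; Tavenas' Cor. 1 is obtained by "using Theorem 1 instead of Theorem 4.1 in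
their paper", Tavenas 2015 p. 5); (2) `ΣΠ^{[a]}ΣΠ^{[b]} → Σ∧^{[a]}Σ∧^{[b]}Σ` by Fischer's identity,
applied to the products (over `a` factors) and to every monomial of the bottom sparse
polynomials (Lemma 4.3 [Fis94], Lemma 4.4); (3) `Σ∧Σ∧Σ → ΣΠΣ` by Saxena's duality trick
(Lemma 4.6 [Sax08]: `(u₁+⋯+u_m)^d = Σ_{i ≤ md+1} Π_j f_{ij}(u_j)` via the truncated exponential
`E_d(u) = Σ_{i≤d} u^i/i!` and interpolation at `md + 1` points) followed by univariate factoring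
over the algebraically closed field (Lemma 4.7, with the wire count
`s₂ · (s₂ a + 1) · O(s₂ a b) · (n + 1)`; size = number of wires, §3).

This file FOLLOWS that proof, library-first:

* Step (1) is the tree's PROVED algebraic core of Tavenas' theorem,
  `DepthReduction.SLP.exists_sum_prod` (`GateQuotients.lean`, used through
  `DepthReduction.exists_slp` of `DepthReductionProofs.lean`): a value of degree `≤ d` of a
  straight-line program of length `L` is, for every cut `t ≥ 1`, a sum of at most
  `(d+1)(16 L² (d+1)⁴)^R` products of at most `W = 1 + 4R` polynomials of degree `≤ t`,
  `R = ⌊8d/(t+1)⌋`.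
* Step (2) is the tree's PROVED polarisation identity `sum_neg_one_pow_mul_sum_pow`
  (`PolarizationIdentity.lean`: `d! · Π y_l = Σ_{S ⊆ [d]} (−1)^{d−|S|} (Σ_{l∈S} y_l)^d`, the
  `2^d`-term form of Fischer's `2^{d-1}`-term identity), used twice: `prod_eq_C_mul_sum_pow`
  (products) and `monomial_eq_C_mul_sum_pow` (monomials as powers of linear forms, §3 here).
* Step (3): the duality identity is proved here from Mathlib's exponential power series
  (`PowerSeries.exp`, `exp_mul_exp_eq_exp_add`, truncation `PowerSeries.trunc`) and Lagrange
  interpolation over `ℚ` at the nodes `0, …, |ι| W` (`Lagrange.eq_interpolate`), lifted to any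
  commutative `ℚ`-algebra by linearity (`sum_pow_eq_sum_prod_aeval`); the factoring is Mathlib's
  `IsAlgClosed.splits` / `Polynomial.Splits.eq_prod_roots` (`aeval_smul_pow_eq_prod_affine`).
* The `ΣΠΣ` circuit itself (`spsCircuit`: a layer of affine weighted-sum gates with `N + 1`
  wires each, a layer of product gates, one output sum; `edgeSize = T'(M(N+2)+1)`,
  `productDepth ≤ 1`) is modelled on `DepthReduction.sigmaPiCircuit`.

## Deviations from print (all forced by the tree's rendering, which quantifies over ALL
`n, s, d`; print assumes `n ≤ s`, Tavenas 2015 p. 3 "as `n ≤ s`", size counting input gates)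

* The construction is run on the restriction of an optimal fan-in-two circuit to the `N ≤ 2L+1`
  variables it reads (`exists_restrict`, renamed back by `ArithCircuit.rename`, which preserves
  wires and product depth, §1), so that affine gates cost `N + 1 ≤ 2L + 2` wires.
* Two degenerate regimes are served by the plain sum of monomials (`sumOfMonomials` of
  `CircuitDepthProductDepthOne.lean`, wire count `edgeSize_sumOfMonomials` here): the *dense*
  regime `d_f lg n ≤ lg L` (then `(d_f+1)² (n+d_f)^{d_f}` wires are within the bound) and the
  *huge-degree* regime `(L+1)³ ≤ d_f` (possible only with `s ≪ n`, since `d_f ≤ 2^L`,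
  `totalDegree_eval_le_two_pow`; then `(d_f+1)^{2L+2}` wires are within the bound).
* Otherwise the cut is `t = max 1 ⌊√(d_f lg L / lg n)⌋` (Tavenas' `√(d log(ds)/log n)` up to
  constants) and `lg` of the wire bound `spsBound` is `O_a(√(d lg n lg s))` (`regime2_le`); the
  bookkeeping is in §6 (`lg x = Nat.log 2 x + 1`, pieces `P` with `P² ≤ c² E` give
  `P ≤ c⌊√E⌋ + c`).

Nothing here is a new named fact (D-0026): every intermediate statement is proved.

## References

* S. Tavenas, *Improved bounds for reduction to depth 4 and depth 3*, Inform. and Comput. 240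
  (2015) 2–11; MFCS 2013 (arXiv:1304.5777): Thm. 1, Cor. 1, §3 (p. 5: the three steps).
* A. Gupta, P. Kamath, N. Kayal, R. Saptharishi, *Arithmetic circuits: a chasm at depth three*,
  SIAM J. Comput. 45(3) (2016) 1064–1079; FOCS 2013; ECCC TR13-026: Thm. 1.1, §3 (size =
  wires), Lemma 4.3 (Fischer), Lemma 4.4, Lemma 4.6 (duality), Lemma 4.7 (factoring and count).
* N. Saxena, *Diagonal circuit identity testing and lower bounds*, ICALP 2008 (the duality
  trick).
* I. Fischer, *Sums of like powers of multivariate linear forms*, Math. Mag. 67 (1994) 59–61.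
* P. Bürgisser, *Completeness and Reduction in Algebraic Complexity Theory*, Springer 2000,
  Def. 2.1, Rem. 2.2.
* N. Limaye, S. Srinivasan, S. Tavenas, *Superpolynomial lower bounds against low-depth
  algebraic circuits*, FOCS 2021, §1 (product depth, size = wires).
-/

noncomputable section

open MvPolynomial

namespace Literature.Computability.AlgebraicComplexity.DepthThree

universe u v

/-! ## §1–§2 Circuit plumbing and the `ΣΠΣ` builder

Renaming (`edgeSize_rename`, `productDepth_rename`), restriction to the occurring variables
(`exists_restrict`), the degree and support bounds (`totalDegree_rename_of_injective`,
`card_support_le_pow_of_totalDegree_le`), the wire count of the plain `ΣΠ` circuit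
(`exists_sumOfMonomials_circuit`) and the `ΣΠΣ` builder (`affVal`, `spsCircuit`,
`eval_spsCircuit`, `edgeSize_spsCircuit`, `productDepth_spsCircuit_le`) are REUSED from
`DepthThreeChasmCircuits.lean` (namespace `DepthThreeChasm`), and the degree bound
`totalDegree_eval_le_two_pow_size` from `BurgisserBooleanPartsA3Steps.lean`. -/

/-- An affine form, given by its coefficient vector and its constant term (the argument type of
`DepthThreeChasm.affVal`). [cite: GuptaKamathKayalSaptharishi2016, §1 eq. (1)] -/
abbrev AffForm (k : Type u) (σ : Type v) := (σ → k) × k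

end Literature.Computability.AlgebraicComplexity.DepthThree

/-! ## §3 Algebra: Fischer's identity, monomials as powers of linear forms, Saxena's duality,
univariate factoring -/

namespace Literature.Computability.AlgebraicComplexity.DepthThree

universe u v

open ArithCircuit DepthReduction DepthThreeChasm

section Fischer

variable {F : Type u} [Field F] [CharZero F] {σ : Type v}

/-- **Fischer's identity** (a product of `W` polynomials is a combination of `2^W` `W`-th
powers of their partial sums), from the polarisation identity `sum_neg_one_pow_mul_sum_pow`.
[cite: GuptaKamathKayalSaptharishi2016, Lemma 4.3 and Lemma 4.4 (Fischer 1994); Tavenas2015, §3] -/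
theorem prod_eq_C_mul_sum_pow {W : ℕ} (y : Fin W → MvPolynomial σ F) :
    ∏ l, y l = C ((W.factorial : F)⁻¹) *
      ∑ S : Finset (Fin W), C ((-1 : F) ^ (W - S.card)) * (∑ l ∈ S, y l) ^ W := by
  have h := sum_neg_one_pow_mul_sum_pow y
  have hC : ∀ S : Finset (Fin W), ((-1 : MvPolynomial σ F) ^ (W - S.card)) =
      C ((-1 : F) ^ (W - S.card)) := fun S => by simp
  simp_rw [hC] at h
  rw [h, ← mul_assoc, ← map_natCast (C : F →+* MvPolynomial σ F), ← map_mul,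
    inv_mul_cancel₀ (Nat.cast_ne_zero.2 (Nat.factorial_ne_zero W)), map_one, one_mul]

end Fischer

section Monomials

variable {F : Type u} [Field F] [CharZero F] {σ : Type v} [Fintype σ] [DecidableEq σ]

/-- The list of variables of a monomial, with multiplicity. [folklore] -/
def mvars (m : σ →₀ ℕ) : List σ := (Finsupp.toMultiset m).toList

omit [Fintype σ] [DecidableEq σ] in
/-- Its length is the degree. [folklore] -/
theorem length_mvars (m : σ →₀ ℕ) : (mvars m).length = m.sum fun _ e => e := by
  rw [mvars, Multiset.length_toList, Finsupp.card_toMultiset]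
  rfl

omit [CharZero F] [Fintype σ] [DecidableEq σ] in
/-- A monomial is the product of its variables. [folklore] -/
theorem monomial_eq_prod_mvars (m : σ →₀ ℕ) :
    (monomial m (1 : F)) = ∏ l : Fin (mvars m).length, X ((mvars m)[l.val]) := by
  rw [Fin.prod_univ_fun_getElem (mvars m) (X : σ → MvPolynomial σ F)]
  have h := eval_monomialGate (k := F) [] m
  simp only [monomialGate, Gate.eval, List.map_map] at h
  rw [← h]
  rfl

/-- The coefficient vector of the linear form `Σ_{l ∈ S} X_{w_l}` attached to a monomial `m`
(variables `w`) and a subset `S` of its variable positions. [cite: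
GuptaKamathKayalSaptharishi2016, Lemma 4.3] -/
def linCoeffs (m : σ →₀ ℕ) (S : Finset (Fin (mvars m).length)) : σ → F :=
  fun v => ((S.filter fun l => (mvars m)[l.val] = v).card : F)

omit [CharZero F] in
/-- The partial sums of the variables of a monomial are the linear forms `linCoeffs`. [folklore] -/
theorem sum_X_mvars_eq (m : σ →₀ ℕ) (S : Finset (Fin (mvars m).length)) :
    ∑ l ∈ S, (X ((mvars m)[l.val]) : MvPolynomial σ F) =
      affVal (linCoeffs (F := F) m S, (0 : F)) := by
  rw [affVal, map_zero, add_zero]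
  rw [← Finset.sum_fiberwise' S (fun l => (mvars m)[l.val]) (fun v => (X v : MvPolynomial σ F))]
  apply Finset.sum_congr rfl
  intro v _
  rw [Finset.sum_const]
  unfold linCoeffs
  rw [Nat.cast_smul_eq_nsmul]

/-- **A monomial of degree `e` is a combination of `2^e` `e`-th powers of linear forms**
(Fischer's identity applied to the product of its variables).
[cite: GuptaKamathKayalSaptharishi2016, Lemma 4.3 and Lemma 4.4] -/
theorem monomial_eq_C_mul_sum_pow (m : σ →₀ ℕ) :
    (monomial m (1 : F)) = C (((mvars m).length.factorial : F)⁻¹) *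
      ∑ S : Finset (Fin (mvars m).length), C ((-1 : F) ^ ((mvars m).length - S.card)) *
        (affVal (linCoeffs (F := F) m S, (0 : F))) ^ (mvars m).length := by
  rw [monomial_eq_prod_mvars, prod_eq_C_mul_sum_pow]
  simp_rw [sum_X_mvars_eq]

end Monomials

section Duality

open Polynomial in
/-- The truncated exponential at the node `r`: `Σ_{i ≤ W} (r^i / i!) Z^i`.
[cite: GuptaKamathKayalSaptharishi2016, Lemma 4.6 (Saxena's duality trick, `E_d(u) = Σ u^i/i!`)] -/
def truncExp (W r : ℕ) : Polynomial ℚ :=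
  ∑ i ∈ Finset.range (W + 1), Polynomial.C ((r : ℚ) ^ i / i.factorial) * Polynomial.X ^ i

/-- The truncated exponential has degree `≤ W`. [folklore] -/
theorem natDegree_truncExp_le (W r : ℕ) : (truncExp W r).natDegree ≤ W := by
  unfold truncExp
  apply Polynomial.natDegree_sum_le_of_forall_le
  intro i hi
  refine (Polynomial.natDegree_C_mul_X_pow_le _ _).trans ?_
  simp only [Finset.mem_range] at hi
  omega

/-- The interpolation weights extracting the coefficient of `Y^W` from the values at the nodes
`0, 1, …, D`. [cite: GuptaKamathKayalSaptharishi2016, Lemma 4.6 (proof: interpolation at `md+1` points)] -/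
def dualWeight (D W r : ℕ) : ℚ :=
  (Lagrange.basis (Finset.range (D + 1)) (Nat.cast : ℕ → ℚ) r).coeff W

/-- The weights extract the coefficient of `Y^W` of the monomials `Y^i`, `i ≤ D`. [folklore] -/
theorem sum_dualWeight_mul_pow {D W i : ℕ} (hi : i ≤ D) :
    ∑ r ∈ Finset.range (D + 1), dualWeight D W r * (r : ℚ) ^ i = if i = W then 1 else 0 := by
  have hinj : Set.InjOn (Nat.cast : ℕ → ℚ) (Finset.range (D + 1) : Set ℕ) :=
    fun a _ b _ h => by exact_mod_cast h
  have hdeg : (Polynomial.X ^ i : Polynomial ℚ).degree < (Finset.range (D + 1)).card := by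
    rw [Polynomial.degree_X_pow, Finset.card_range]
    exact_mod_cast Nat.lt_succ_of_le hi
  have h := Lagrange.eq_interpolate hinj hdeg
  have hc := congrArg (fun p : Polynomial ℚ => p.coeff W) h
  simp only [Lagrange.interpolate_apply, Polynomial.eval_pow, Polynomial.eval_X,
    Polynomial.finsetSum_coeff, Polynomial.coeff_C_mul, Polynomial.coeff_X_pow] at hc
  rw [eq_comm] at hc
  simpa [dualWeight, mul_comm, eq_comm] using hc

variable {A : Type u} [CommRing A] [Algebra ℚ A]

/-- Coefficient extraction by interpolation, over any commutative `ℚ`-algebra.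
[cite: GuptaKamathKayalSaptharishi2016, Lemma 4.6 (proof)] -/
theorem sum_dualWeight_eval {D W : ℕ} (G : Polynomial A) (hG : G.natDegree ≤ D) :
    ∑ r ∈ Finset.range (D + 1), algebraMap ℚ A (dualWeight D W r) * G.eval (r : A) =
      G.coeff W := by
  have hev : ∀ r : ℕ, G.eval (r : A) =
      ∑ i ∈ Finset.range (D + 1), G.coeff i * (r : A) ^ i := fun r =>
    Polynomial.eval_eq_sum_range' (Nat.lt_succ_of_le hG) _
  simp_rw [hev, Finset.mul_sum]
  rw [Finset.sum_comm]
  have hinner : ∀ i ∈ Finset.range (D + 1),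
      ∑ r ∈ Finset.range (D + 1), algebraMap ℚ A (dualWeight D W r) * (G.coeff i * (r : A) ^ i) =
        G.coeff i * algebraMap ℚ A (if i = W then 1 else 0) := by
    intro i hi
    simp only [Finset.mem_range] at hi
    rw [← sum_dualWeight_mul_pow (Nat.le_of_lt_succ hi), map_sum, Finset.mul_sum]
    apply Finset.sum_congr rfl
    intro r _
    rw [map_mul, map_pow, map_natCast]
    ring
  rw [Finset.sum_congr rfl hinner]
  simp only [apply_ite, map_one, map_zero, mul_one, mul_zero]
  rw [Finset.sum_ite_eq']
  split_ifs with h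
  · rfl
  · simp only [Finset.mem_range, not_lt] at h
    exact (Polynomial.coeff_eq_zero_of_natDegree_lt (by omega)).symm

/-- `Π_{j ∈ s} e^{z_j Y} = e^{(Σ_{j ∈ s} z_j) Y}`. [folklore] -/
theorem prod_rescale_exp {ι : Type*} (s : Finset ι) (z : ι → A) :
    ∏ j ∈ s, PowerSeries.rescale (z j) (PowerSeries.exp A) =
      PowerSeries.rescale (∑ j ∈ s, z j) (PowerSeries.exp A) := by
  classical
  induction s using Finset.induction_on with
  | empty =>
    simp [PowerSeries.rescale_zero, PowerSeries.constantCoeff_exp]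
  | insert a s ha ih =>
    rw [Finset.prod_insert ha, Finset.sum_insert ha, ih, PowerSeries.exp_mul_exp_eq_exp_add]

omit [Algebra ℚ A] in
/-- Truncation commutes with finite products up to the truncation order. [folklore] -/
theorem trunc_prod_trunc {ι : Type*} (s : Finset ι) (n : ℕ) (φ : ι → PowerSeries A) :
    PowerSeries.trunc n (∏ j ∈ s, (PowerSeries.trunc n (φ j) : PowerSeries A)) =
      PowerSeries.trunc n (∏ j ∈ s, φ j) := by
  classical
  induction s using Finset.induction_on with
  | empty => simp
  | insert a s ha ih =>
    rw [Finset.prod_insert ha, Finset.prod_insert ha, PowerSeries.trunc_trunc_mul,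
      ← PowerSeries.trunc_mul_trunc, ih, PowerSeries.trunc_mul_trunc]

/-- The truncated exponential polynomial `Σ_{i ≤ W} z^i/i! Y^i ∈ A[Y]`. [folklore] -/
def expPoly (W : ℕ) (z : A) : Polynomial A :=
  PowerSeries.trunc (W + 1) (PowerSeries.rescale z (PowerSeries.exp A))

/-- The truncated exponential polynomial has degree `≤ W`. [folklore] -/
theorem natDegree_expPoly_le (W : ℕ) (z : A) : (expPoly W z).natDegree ≤ W :=
  Nat.le_of_lt_succ (PowerSeries.natDegree_trunc_lt _ _)

/-- **The generating identity behind the duality trick**: the coefficient of `Y^W` in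
`Π_j Σ_{i ≤ W} z_j^i Y^i / i!` is `(Σ_j z_j)^W / W!`.
[cite: GuptaKamathKayalSaptharishi2016, Lemma 4.6 (proof, Saxena 2008)] -/
theorem coeff_prod_expPoly {ι : Type*} [Fintype ι] (W : ℕ) (z : ι → A) :
    (∏ j, expPoly W (z j)).coeff W = (∑ j, z j) ^ W * algebraMap ℚ A (1 / W.factorial) := by
  rw [← Polynomial.coeff_coe]
  change PowerSeries.coeff W (Polynomial.coeToPowerSeries.ringHom (R := A) (∏ j, expPoly W (z j))) = _
  rw [map_prod]
  simp only [Polynomial.coeToPowerSeries.ringHom_apply, expPoly]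
  rw [← PowerSeries.coeff_coe_trunc_of_lt (Nat.lt_succ_self W), trunc_prod_trunc,
    PowerSeries.coeff_coe_trunc_of_lt (Nat.lt_succ_self W), prod_rescale_exp,
    PowerSeries.coeff_rescale, PowerSeries.coeff_exp]

/-- The value of the truncated exponential polynomial at the node `r` is the univariate
polynomial `truncExp W r` evaluated at `z`. [folklore] -/
theorem eval_expPoly (W : ℕ) (z : A) (r : ℕ) :
    (expPoly W z).eval (r : A) = Polynomial.aeval z (truncExp W r) := by
  rw [Polynomial.eval_eq_sum_range' (Nat.lt_succ_of_le (natDegree_expPoly_le W z)), truncExp,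
    map_sum]
  apply Finset.sum_congr rfl
  intro i hi
  simp only [Finset.mem_range] at hi
  rw [expPoly, PowerSeries.coeff_trunc, if_pos hi, PowerSeries.coeff_rescale,
    PowerSeries.coeff_exp, map_mul, Polynomial.aeval_C, map_pow, Polynomial.aeval_X,
    div_eq_mul_one_div ((r : ℚ) ^ i), map_mul, map_pow, map_natCast]
  ring

/-- **Saxena's duality trick** (with interpolation at the nodes `0, …, |ι|·W`): a `W`-th power
of a sum is a short sum of products of univariate polynomials in the summands,
`(Σ_j z_j)^W = Σ_{r ≤ |ι| W} W! β_r Π_j truncExp_{W,r}(z_j)`.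
[cite: GuptaKamathKayalSaptharishi2016, Lemma 4.6; Saxena2008; Tavenas2015, §3 (third step)] -/
theorem sum_pow_eq_sum_prod_aeval {ι : Type*} [Fintype ι] (W : ℕ) (z : ι → A) :
    (∑ j, z j) ^ W = ∑ r ∈ Finset.range (Fintype.card ι * W + 1),
      algebraMap ℚ A ((W.factorial : ℚ) * dualWeight (Fintype.card ι * W) W r) *
        ∏ j, Polynomial.aeval (z j) (truncExp W r) := by
  set D := Fintype.card ι * W with hD
  set G : Polynomial A := ∏ j, expPoly W (z j) with hG
  have hGdeg : G.natDegree ≤ D := by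
    refine (Polynomial.natDegree_prod_le _ _).trans ?_
    refine (Finset.sum_le_card_nsmul _ _ W fun j _ => natDegree_expPoly_le W (z j)).trans ?_
    simp [hD]
  have hext := sum_dualWeight_eval (W := W) G hGdeg
  rw [hG, coeff_prod_expPoly] at hext
  have hev : ∀ r : ℕ, (∏ j, expPoly W (z j)).eval (r : A) =
      ∏ j, Polynomial.aeval (z j) (truncExp W r) := fun r => by
    rw [Polynomial.eval_prod]
    simp_rw [eval_expPoly]
  simp_rw [hev] at hext
  have hW : algebraMap ℚ A (W.factorial : ℚ) * algebraMap ℚ A (1 / W.factorial) = 1 := by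
    rw [← map_mul, mul_one_div_cancel (Nat.cast_ne_zero.2 (Nat.factorial_ne_zero W)), map_one]
  calc (∑ j, z j) ^ W = (∑ j, z j) ^ W * (algebraMap ℚ A (W.factorial : ℚ) *
        algebraMap ℚ A (1 / W.factorial)) := by rw [hW, mul_one]
    _ = algebraMap ℚ A (W.factorial : ℚ) * ((∑ j, z j) ^ W * algebraMap ℚ A (1 / W.factorial)) := by
        ring
    _ = _ := by
        rw [← hext, Finset.mul_sum]
        apply Finset.sum_congr rfl
        intro r _
        rw [map_mul]
        ring

end Duality

section Factoring

variable {σ : Type v} [Fintype σ]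

/-- **Univariate factoring over `ℂ`** (the third step of GKKS): a univariate polynomial of
degree `≤ W` evaluated at `c · ℓ^e`, `ℓ` a linear form, is a scalar times a product of at most
`W e` affine forms `ℓ − ρ`. [cite: GuptaKamathKayalSaptharishi2016, Lemma 4.7
(proof: "it splits as a product of linear factors over the algebraically closed base field")] -/
theorem aeval_smul_pow_eq_prod_affine {W : ℕ} (u : Polynomial ℚ) (hu : u.natDegree ≤ W) (c : ℂ) (e : ℕ)
    (a : σ → ℂ) :
    ∃ (lc : ℂ) (L : List (AffForm ℂ σ)), L.length ≤ W * e ∧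
      Polynomial.aeval (c • (affVal (a, (0 : ℂ))) ^ e) u =
        C lc * (L.map affVal).prod := by
  set ℓ : MvPolynomial σ ℂ := affVal (a, (0 : ℂ)) with hℓ
  set v : Polynomial ℂ := (u.map (algebraMap ℚ ℂ)).comp (Polynomial.C c * Polynomial.X ^ e) with hv
  have hcomp : Polynomial.aeval (c • ℓ ^ e) u = Polynomial.aeval ℓ v := by
    rw [hv, Polynomial.aeval_comp, Polynomial.aeval_map_algebraMap]
    congr 1
    simp [Algebra.smul_def]
  have hdeg : v.natDegree ≤ W * e := by
    refine Polynomial.natDegree_comp_le.trans ?_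
    exact Nat.mul_le_mul (Polynomial.natDegree_map_le.trans hu)
      (Polynomial.natDegree_C_mul_X_pow_le c e)
  have hcard : v.roots.toList.length ≤ W * e := by
    rw [Multiset.length_toList]
    exact (Polynomial.card_roots' v).trans hdeg
  have hsplit := (IsAlgClosed.splits v).eq_prod_roots
  set lc := v.leadingCoeff with hlc
  set rts := v.roots with hrts
  refine ⟨lc, rts.toList.map fun ρ => (a, -ρ), by rwa [List.length_map], ?_⟩
  rw [hcomp, hsplit, map_mul, Polynomial.aeval_C, MvPolynomial.algebraMap_eq, map_multiset_prod,
    Multiset.map_map, List.map_map]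
  congr 1
  rw [← Multiset.prod_coe, ← Multiset.map_coe, Multiset.coe_toList]
  congr 1
  apply Multiset.map_congr rfl
  intro ρ _
  simp only [Function.comp, map_sub, Polynomial.aeval_X, Polynomial.aeval_C,
    MvPolynomial.algebraMap_eq, hℓ, affVal, map_zero, add_zero, map_neg]
  ring

end Factoring

end Literature.Computability.AlgebraicComplexity.DepthThree

/-! ## §4 The `ΣΠΣ` normal form of a sum of products of low-degree polynomials -/

namespace Literature.Computability.AlgebraicComplexity.DepthThree

universe v

open ArithCircuit DepthReduction DepthThreeChasm

section NormalForm

variable {σ : Type v} [Fintype σ] [DecidableEq σ] (U : Finset (σ →₀ ℕ))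

/-- Index of the power terms `(m, S')`: a monomial of `U` and a subset of its variable
positions. [cite: GuptaKamathKayalSaptharishi2016, Lemma 4.4 (the `Σ∧Σ∧Σ` circuit)] -/
abbrev PowIdx := Σ m : U, Finset (Fin (mvars m.1).length)

/-- Exponent of a power term. [cite: GuptaKamathKayalSaptharishi2016, Lemma 4.4] -/
def powExp (j : PowIdx U) : ℕ := (mvars j.1.1).length

/-- Linear form of a power term. [cite: GuptaKamathKayalSaptharishi2016, Lemma 4.4] -/
def powBase (j : PowIdx U) : AffForm ℂ σ := (linCoeffs (F := ℂ) j.1.1 j.2, (0 : ℂ))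

/-- Coefficient of a power term in the expansion of `q`. [cite: GuptaKamathKayalSaptharishi2016, Lemma 4.4] -/
def powCoeff (q : MvPolynomial σ ℂ) (j : PowIdx U) : ℂ :=
  coeff j.1.1 q * ((((mvars j.1.1).length).factorial : ℂ)⁻¹ *
    (-1) ^ ((mvars j.1.1).length - j.2.card))

omit [Fintype σ] [DecidableEq σ] in
/-- Number of power terms: at most `#U · 2^t` if all monomials of `U` have degree `≤ t`.
[cite: GuptaKamathKayalSaptharishi2016, Lemma 4.4 (size `(s³abn)·2^{a+b}` of the `Σ∧Σ∧Σ` circuit)] -/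
theorem card_powIdx_le {t : ℕ} (hU : ∀ m ∈ U, (mvars m).length ≤ t) :
    Fintype.card (PowIdx U) ≤ U.card * 2 ^ t := by
  rw [Fintype.card_sigma]
  calc ∑ m : U, Fintype.card (Finset (Fin (mvars m.1).length))
      ≤ ∑ _m : U, 2 ^ t := by
        apply Finset.sum_le_sum
        intro m _
        rw [Fintype.card_finset, Fintype.card_fin]
        exact Nat.pow_le_pow_right (by norm_num) (hU m.1 m.2)
    _ = U.card * 2 ^ t := by simp

/-- **Step 2 (Fischer on the monomials): a polynomial supported in `U` is a combination of the
powers of linear forms indexed by `PowIdx U`.**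
[cite: GuptaKamathKayalSaptharishi2016, Lemma 4.3 and Lemma 4.4] -/
theorem eq_sum_powIdx (q : MvPolynomial σ ℂ) (hq : q.support ⊆ U) :
    q = ∑ j : PowIdx U, powCoeff U q j • affVal (powBase U j) ^ powExp U j := by
  have h1 : q = ∑ m ∈ U, C (coeff m q) * monomial m (1 : ℂ) := by
    conv_lhs => rw [as_sum q]
    rw [← Finset.sum_subset hq (fun m _ hm => by
      rw [notMem_support_iff.1 hm]; simp)]
    apply Finset.sum_congr rfl
    intro m _
    rw [C_mul_monomial, mul_one]
  conv_lhs => rw [h1, ← Finset.sum_coe_sort U]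
  rw [Fintype.sum_sigma]
  apply Finset.sum_congr rfl
  rintro ⟨m, hm⟩ -
  rw [monomial_eq_C_mul_sum_pow, Finset.mul_sum, Finset.mul_sum]
  apply Finset.sum_congr rfl
  intro S _
  simp only [powCoeff, powBase, powExp, smul_eq_C_mul, map_mul]
  ring

/-- **Step 3 for one product of power terms: duality factors and univariate factoring.**
`Π_j truncExp_{W,r}(c_j ℓ_j^{e_j})` is a scalar times a product of at most `|PowIdx|·W·t` affine
forms. [cite: GuptaKamathKayalSaptharishi2016, Lemma 4.7] -/
theorem prod_aeval_eq_C_mul_prod {W t : ℕ} (hU : ∀ m ∈ U, (mvars m).length ≤ t)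
    (c : PowIdx U → ℂ) (r : ℕ) :
    ∃ (lc : ℂ) (Λ : List (AffForm ℂ σ)), Λ.length ≤ Fintype.card (PowIdx U) * (W * t) ∧
      ∏ j, Polynomial.aeval (c j • affVal (powBase U j) ^ powExp U j) (truncExp W r) =
        C lc * (Λ.map affVal).prod := by
  have hj : ∀ j : PowIdx U, ∃ (lc : ℂ) (L : List (AffForm ℂ σ)), L.length ≤ W * t ∧
      Polynomial.aeval (c j • affVal (powBase U j) ^ powExp U j) (truncExp W r) =
        C lc * (L.map affVal).prod := by
    intro j
    obtain ⟨lc, L, hL, heq⟩ := aeval_smul_pow_eq_prod_affine (truncExp W r)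
      (natDegree_truncExp_le W r) (c j) (powExp U j) (linCoeffs (F := ℂ) j.1.1 j.2)
    exact ⟨lc, L, hL.trans (Nat.mul_le_mul_left W (hU j.1.1 j.1.2)), heq⟩
  choose lc L hLlen hLeq using hj
  refine ⟨∏ j, lc j, (Finset.univ : Finset (PowIdx U)).toList.flatMap L, ?_, ?_⟩
  · rw [List.length_flatMap]
    refine (List.sum_le_card_nsmul _ (W * t) ?_).trans ?_
    · intro x hx
      obtain ⟨j, -, rfl⟩ := List.mem_map.1 hx
      exact hLlen j
    · simp [Finset.length_toList]
  · simp_rw [hLeq]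
    rw [Finset.prod_mul_distrib, map_prod]
    congr 1
    rw [List.map_flatMap, List.flatMap_def, List.prod_flatten, List.map_map,
      Finset.prod_map_toList]
    rfl

variable {U}

/-- **Steps 2–3 for one product `Π_{π<W} p_π` of polynomials supported in `U`** (Fischer over
`π`, expansion in powers of linear forms, duality, factoring): a sum over
`S ⊆ [W]`, `r ≤ |PowIdx|·W` of scalars times products of at most `|PowIdx|·W·t` affine forms.
[cite: GuptaKamathKayalSaptharishi2016, Lemmas 4.4, 4.6, 4.7; Tavenas2015, Cor. 1] -/
theorem prod_eq_sum_sps {W t : ℕ} (hU : ∀ m ∈ U, (mvars m).length ≤ t)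
    (p : Fin W → MvPolynomial σ ℂ) (hp : ∀ π, (p π).support ⊆ U) :
    ∃ (γ : Finset (Fin W) → Fin (Fintype.card (PowIdx U) * W + 1) → ℂ)
      (Λ : Finset (Fin W) → Fin (Fintype.card (PowIdx U) * W + 1) → List (AffForm ℂ σ)),
      (∀ S r, (Λ S r).length ≤ Fintype.card (PowIdx U) * (W * t)) ∧
      ∏ π, p π = ∑ S, ∑ r, γ S r • ((Λ S r).map affVal).prod := by
  classical
  set D := Fintype.card (PowIdx U) * W with hD
  -- the partial sums and their power-term coefficients
  set q : Finset (Fin W) → MvPolynomial σ ℂ := fun S => ∑ π ∈ S, p π with hq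
  have hqU : ∀ S, (q S).support ⊆ U := fun S =>
    (MvPolynomial.support_sum (s := S) (f := p)).trans (Finset.biUnion_subset.2 fun π _ => hp π)
  set c : Finset (Fin W) → PowIdx U → ℂ := fun S j => powCoeff U (q S) j with hc
  have hfac := fun S (r : ℕ) => prod_aeval_eq_C_mul_prod U (W := W) hU (c S) r
  choose lc Λ hΛlen hΛeq using hfac
  refine ⟨fun S r => ((W.factorial : ℂ)⁻¹ * (-1) ^ (W - S.card)) *
      (algebraMap ℚ ℂ ((W.factorial : ℚ) * dualWeight D W r.val) * lc S r.val),
    fun S r => Λ S r.val, fun S r => hΛlen S r.val, ?_⟩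
  rw [prod_eq_C_mul_sum_pow, Finset.mul_sum]
  apply Finset.sum_congr rfl
  intro S _
  have hpow : (∑ l ∈ S, p l) ^ W = ∑ r ∈ Finset.range (D + 1),
      C (algebraMap ℚ ℂ ((W.factorial : ℚ) * dualWeight D W r) * lc S r) *
        ((Λ S r).map affVal).prod := by
    change (q S) ^ W = _
    rw [eq_sum_powIdx U (q S) (hqU S), sum_pow_eq_sum_prod_aeval W]
    apply Finset.sum_congr rfl
    intro r _
    rw [IsScalarTower.algebraMap_apply ℚ ℂ (MvPolynomial σ ℂ), MvPolynomial.algebraMap_eq]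
    change _ * ∏ j, Polynomial.aeval (c S j • affVal (powBase U j) ^ powExp U j) (truncExp W r) = _
    rw [hΛeq S r, ← mul_assoc, ← map_mul]
  rw [hpow, Finset.mul_sum, Finset.mul_sum, ← Fin.sum_univ_eq_sum_range]
  apply Finset.sum_congr rfl
  intro r _
  rw [smul_eq_C_mul, ← mul_assoc, ← mul_assoc, ← map_mul, ← map_mul]

/-- **The `ΣΠΣ` normal form** of `Σ_{τ<T} Π_{π<W} p_{τπ}`, `deg p_{τπ} ≤ t` (`1 ≤ t`), over `N`
variables: `Σ_{τ'<T'} coef_{τ'} Π_{κ<M} aff_{τ'κ}` with affine `aff`, where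
`M ≤ μ W t`, `T' ≤ T 2^W (μ W + 1)`, `μ = (t+1)(N+t)^t 2^t`.
[cite: GuptaKamathKayalSaptharishi2016, Thm. 1.1 (proof, §4: Lemmas 4.3–4.7); Tavenas2015, Cor. 1] -/
theorem exists_sps_repr {T W t : ℕ} (ht : 1 ≤ t) (p : Fin T → Fin W → MvPolynomial σ ℂ)
    (hp : ∀ τ π, (p τ π).totalDegree ≤ t) :
    ∃ (T' M : ℕ) (coef : Fin T' → ℂ) (aff : Fin T' → Fin M → AffForm ℂ σ),
      (∑ τ', coef τ' • ∏ κ, affVal (aff τ' κ)) = ∑ τ, ∏ π, p τ π ∧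
      M ≤ (t + 1) * (Fintype.card σ + t) ^ t * 2 ^ t * W * t ∧
      T' ≤ T * 2 ^ W * ((t + 1) * (Fintype.card σ + t) ^ t * 2 ^ t * W + 1) := by
  classical
  set U : Finset (σ →₀ ℕ) := (Finset.univ : Finset (Fin T × Fin W)).biUnion
    fun x => (p x.1 x.2).support with hUdef
  have hpU : ∀ τ π, (p τ π).support ⊆ U := fun τ π =>
    Finset.subset_biUnion_of_mem (fun x : Fin T × Fin W => (p x.1 x.2).support)
      (Finset.mem_univ (τ, π))
  have hUdeg : ∀ m ∈ U, (m.sum fun _ e => e) ≤ t := by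
    intro m hm
    simp only [hUdef, Finset.mem_biUnion, Finset.mem_univ, true_and] at hm
    obtain ⟨⟨τ, π⟩, hm⟩ := hm
    exact (le_totalDegree hm).trans (hp τ π)
  have hU : ∀ m ∈ U, (mvars m).length ≤ t := fun m hm => by
    rw [length_mvars]; exact hUdeg m hm
  have hUcard : U.card ≤ (t + 1) * (Fintype.card σ + t) ^ t := card_le_of_degree_le U ht hUdeg
  have hcJle : Fintype.card (PowIdx U) ≤ (t + 1) * (Fintype.card σ + t) ^ t * 2 ^ t :=
    (card_powIdx_le U hU).trans (Nat.mul_le_mul_right _ hUcard)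
  have hone := fun τ => prod_eq_sum_sps (W := W) hU (p τ) (hpU τ)
  choose γ Λ hΛlen hΛeq using hone
  -- reindexing
  let e := Fintype.equivFin (Fin T × Finset (Fin W) × Fin (Fintype.card (PowIdx U) * W + 1))
  let d1 : AffForm ℂ σ := ((0 : σ → ℂ), (1 : ℂ))
  refine ⟨Fintype.card (Fin T × Finset (Fin W) × Fin (Fintype.card (PowIdx U) * W + 1)),
    Fintype.card (PowIdx U) * (W * t),
    fun τ' => γ (e.symm τ').1 (e.symm τ').2.1 (e.symm τ').2.2,
    fun τ' κ => (Λ (e.symm τ').1 (e.symm τ').2.1 (e.symm τ').2.2).getD κ.val d1, ?_, ?_, ?_⟩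
  · -- the identity
    have hprod : ∀ i : Fin T × Finset (Fin W) × Fin (Fintype.card (PowIdx U) * W + 1),
        ∏ κ : Fin (Fintype.card (PowIdx U) * (W * t)), affVal ((Λ i.1 i.2.1 i.2.2).getD κ.val d1) =
        ((Λ i.1 i.2.1 i.2.2).map affVal).prod := by
      intro i
      rw [← prod_getD_one ((Λ i.1 i.2.1 i.2.2).map affVal)
        (Fintype.card (PowIdx U) * (W * t)) (by rw [List.length_map]; exact hΛlen _ _ _)]
      apply Fintype.prod_congr
      intro κ
      rw [← affVal_zero_one (k := ℂ) (σ := σ), List.getD_map]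
    calc (∑ τ' : Fin _, γ (e.symm τ').1 (e.symm τ').2.1 (e.symm τ').2.2 •
          ∏ κ : Fin (Fintype.card (PowIdx U) * (W * t)),
            affVal ((Λ (e.symm τ').1 (e.symm τ').2.1 (e.symm τ').2.2).getD κ.val d1))
        = ∑ i : Fin T × Finset (Fin W) × Fin (Fintype.card (PowIdx U) * W + 1),
            γ i.1 i.2.1 i.2.2 • ∏ κ : Fin (Fintype.card (PowIdx U) * (W * t)),
              affVal ((Λ i.1 i.2.1 i.2.2).getD κ.val d1) :=
          Fintype.sum_equiv e.symm _ _ fun _ => rfl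
      _ = ∑ i : Fin T × Finset (Fin W) × Fin (Fintype.card (PowIdx U) * W + 1),
            γ i.1 i.2.1 i.2.2 • ((Λ i.1 i.2.1 i.2.2).map affVal).prod := by
          simp_rw [hprod]
      _ = ∑ τ, ∑ S : Finset (Fin W), ∑ r : Fin (Fintype.card (PowIdx U) * W + 1),
            γ τ S r • ((Λ τ S r).map affVal).prod := by
          simp only [Fintype.sum_prod_type]
      _ = ∑ τ, ∏ π, p τ π := by simp_rw [← hΛeq]
  · calc Fintype.card (PowIdx U) * (W * t)
        ≤ (t + 1) * (Fintype.card σ + t) ^ t * 2 ^ t * (W * t) := Nat.mul_le_mul_right _ hcJle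
      _ = _ := by ring
  · simp only [Fintype.card_prod, Fintype.card_fin, Fintype.card_finset]
    rw [← mul_assoc]
    gcongr

end NormalForm

end Literature.Computability.AlgebraicComplexity.DepthThree

/-! ## §5 The two circuits and their wire counts: the plain sum of monomials, and the
`ΣΠΣ` circuit of a value of a straight-line program for a given degree cut `t` -/

namespace Literature.Computability.AlgebraicComplexity.DepthThree

universe u v

open ArithCircuit DepthReduction DepthThreeChasm



section CutCircuit

variable {σ : Type v} [Fintype σ] [DecidableEq σ]

/-- The wire bound of the `ΣΠΣ` circuit for the cut `t`:
`T₀ · 2^W · (μ W + 1) · (μ W t (N + 2) + 1)` with `R = ⌊8d/(t+1)⌋`, `W = 1 + 4R`,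
`T₀ = (d+1) (16 s² (d+1)⁴)^R`, `μ = (t+1)(N+t)^t 2^t`.
[cite: GuptaKamathKayalSaptharishi2016, Thm. 1.1 (proof); Tavenas2015, Thm. 1 and Cor. 1] -/
def spsBound (N d s t : ℕ) : ℕ :=
  ((d + 1) * ((4 * s * (d + 1) ^ 2) * (4 * s * (d + 1) ^ 2)) ^ (8 * d / (t + 1))) *
    2 ^ (1 + 4 * (8 * d / (t + 1))) *
    ((t + 1) * (N + t) ^ t * 2 ^ t * (1 + 4 * (8 * d / (t + 1))) + 1) *
    ((t + 1) * (N + t) ^ t * 2 ^ t * (1 + 4 * (8 * d / (t + 1))) * t * (N + 2) + 1)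

/-- **Depth three for a given cut.** A value of total degree `≤ d` of a straight-line program of
length `s` over `N` variables has, for every `t ≥ 1`, a `ΣΠΣ` circuit (product-depth `≤ 1`)
with at most `spsBound N d s t` wires: Tavenas' depth-four expansion at bottom degree `t`
(`SLP.exists_sum_prod`), Fischer's identity, Saxena's duality and univariate factoring
over `ℂ`, realised by `spsCircuit`.
[cite: GuptaKamathKayalSaptharishi2016, Thm. 1.1; Tavenas2015, Cor. 1] -/
theorem exists_sps_of_slp (S : SLP ℂ σ) {i : ℕ} (hi : i < S.len) {d t : ℕ}
    (hd : (S.val i).totalDegree ≤ d) (ht : 1 ≤ t) :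
    ∃ C : ArithCircuit ℂ σ, C.eval = S.val i ∧ C.productDepth ≤ 1 ∧
      C.edgeSize ≤ spsBound (Fintype.card σ) d S.len t := by
  obtain ⟨L, hsum, hlen, hT⟩ := S.exists_sum_prod d ht hi hd
  set W := 1 + 4 * (8 * d / (t + 1)) with hW
  let p : Fin L.length → Fin W → MvPolynomial σ ℂ := fun τ π => (L[τ.val]).getD π.val 1
  have hp : ∀ τ π, (p τ π).totalDegree ≤ t := by
    intro τ π
    rcases getD_one_mem_or (L[τ.val]) π.val with h | h
    · exact (hT _ (List.getElem_mem _)).2 _ h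
    · simp only [p]
      rw [h, totalDegree_one]
      exact Nat.zero_le _
  have hpsum : ∑ τ, ∏ π, p τ π = S.val i := by
    rw [← hsum]
    have : ∀ τ : Fin L.length, ∏ π : Fin W, p τ π = (L[τ.val]).prod := fun τ =>
      prod_getD_one _ W (hT _ (List.getElem_mem _)).1
    simp only [this]
    exact Fin.sum_univ_fun_getElem L List.prod
  obtain ⟨T', M, coef, aff, heq, hM, hT'⟩ := exists_sps_repr ht p hp
  refine ⟨spsCircuit T' M coef aff, by rw [eval_spsCircuit, heq, hpsum],
    productDepth_spsCircuit_le T' M coef aff, ?_⟩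
  rw [edgeSize_spsCircuit, spsBound, ← hW]
  set μ := (t + 1) * (Fintype.card σ + t) ^ t * 2 ^ t with hμ
  set T₀ := (d + 1) * ((4 * S.len * (d + 1) ^ 2) * (4 * S.len * (d + 1) ^ 2)) ^ (8 * d / (t + 1))
    with hT₀
  have hT'' : T' ≤ T₀ * 2 ^ W * (μ * W + 1) :=
    hT'.trans (Nat.mul_le_mul_right _ (Nat.mul_le_mul_right _ hlen))
  calc T' * M * (Fintype.card σ + 1) + T' * M + T' = T' * (M * (Fintype.card σ + 2) + 1) := by ring
    _ ≤ (T₀ * 2 ^ W * (μ * W + 1)) * (μ * W * t * (Fintype.card σ + 2) + 1) := by gcongr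

end CutCircuit

end Literature.Computability.AlgebraicComplexity.DepthThree

/-! ## §6 Arithmetic: binary logarithms, the choice of the cut, the three regimes -/

namespace Literature.Computability.AlgebraicComplexity.DepthThree

section Log

/-- `lg x = ⌊log₂ x⌋ + 1`, so that `x < 2 ^ lg x` for every `x` (and `lg n = Nat.log 2 n + 1` is
the quantity in the statement of the fact). [folklore] -/
def lg (x : ℕ) : ℕ := Nat.log 2 x + 1

/-- `x < 2 ^ lg x`. [folklore] -/
theorem lt_two_pow_lg (x : ℕ) : x < 2 ^ lg x := by
  rcases Nat.eq_zero_or_pos x with rfl | _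
  · simp [lg]
  · exact Nat.lt_pow_succ_log_self one_lt_two x

/-- `1 ≤ lg x`. [folklore] -/
theorem one_le_lg (x : ℕ) : 1 ≤ lg x := Nat.le_add_left _ _

/-- `lg` is monotone. [folklore] -/
theorem lg_mono {x y : ℕ} (h : x ≤ y) : lg x ≤ lg y :=
  Nat.add_le_add_right (Nat.log_mono_right h) 1

/-- `x < 2^e`, `1 ≤ e` give `lg x ≤ e`. [folklore] -/
theorem lg_le_of_lt_two_pow {x e : ℕ} (he : 1 ≤ e) (h : x < 2 ^ e) : lg x ≤ e := by
  rcases Nat.eq_zero_or_pos x with rfl | hx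
  · simpa [lg] using he
  · exact Nat.log_lt_of_lt_pow (Nat.pos_iff_ne_zero.1 hx) h

/-- `x ≤ 2^e` gives `lg x ≤ e + 1`. [folklore] -/
theorem lg_le_of_le_two_pow {x e : ℕ} (h : x ≤ 2 ^ e) : lg x ≤ e + 1 :=
  lg_le_of_lt_two_pow (Nat.succ_pos e) (lt_of_le_of_lt h (Nat.pow_lt_pow_succ one_lt_two))

/-- `lg (x y) ≤ lg x + lg y`. [folklore] -/
theorem lg_mul_le (x y : ℕ) : lg (x * y) ≤ lg x + lg y := by
  apply lg_le_of_lt_two_pow ((one_le_lg x).trans (Nat.le_add_right _ _))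
  rw [pow_add]
  exact Nat.mul_lt_mul'' (lt_two_pow_lg x) (lt_two_pow_lg y)

/-- `lg (x^t) ≤ t lg x + 1`. [folklore] -/
theorem lg_pow_le (x t : ℕ) : lg (x ^ t) ≤ t * lg x + 1 := by
  apply lg_le_of_le_two_pow
  rw [mul_comm, pow_mul]
  exact Nat.pow_le_pow_left (lt_two_pow_lg x).le t

/-- `lg (2^e) = e + 1`. [folklore] -/
theorem lg_two_pow (e : ℕ) : lg (2 ^ e) = e + 1 := by
  rw [lg, Nat.log_pow one_lt_two]

/-- `lg x ≤ x + 1`. [folklore] -/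
theorem lg_le_succ (x : ℕ) : lg x ≤ x + 1 :=
  Nat.add_le_add_right (Nat.log_le_self 2 x) 1

/-- `lg (x + 1) ≤ lg x + 1`. [folklore] -/
theorem lg_succ_le (x : ℕ) : lg (x + 1) ≤ lg x + 1 := by
  apply lg_le_of_lt_two_pow (Nat.succ_pos _)
  have := lt_two_pow_lg x
  rw [pow_succ]
  omega

/-- `lg 0 = 1`. [folklore] -/
theorem lg_zero : lg 0 = 1 := by simp [lg]

/-- `lg 2 = 2`. [folklore] -/
theorem lg_two : lg 2 = 2 := by simpa using lg_two_pow 1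

/-- `lg 3 = 2`. [folklore] -/
theorem lg_three : lg 3 = 2 := by
  have h : Nat.log 2 3 = 1 := by rw [Nat.log_eq_iff] <;> norm_num
  rw [lg, h]

/-- `lg 4 = 3`. [folklore] -/
theorem lg_four : lg 4 = 3 := by
  rw [show (4 : ℕ) = 2 ^ 2 by norm_num, lg_two_pow]

/-- `lg (x + 2) ≤ lg x + 3` and the like. [folklore] -/
theorem lg_add_le (x c : ℕ) : lg (x + c) ≤ lg x + lg (c + 1) := by
  rcases Nat.eq_zero_or_pos x with rfl | hx
  · rw [zero_add, lg_zero]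
    have := lg_mono (Nat.le_add_right c 1)
    omega
  · calc lg (x + c) ≤ lg (x * (c + 1)) := lg_mono (by nlinarith)
      _ ≤ lg x + lg (c + 1) := lg_mul_le _ _

/-- `X² ≤ c² Y` gives `X ≤ c ⌊√Y⌋ + c`. [folklore] -/
theorem le_mul_sqrt_add {X c Y : ℕ} (h : X * X ≤ c * c * Y) : X ≤ c * Nat.sqrt Y + c := by
  have hs := Nat.lt_succ_sqrt' Y
  rw [← Nat.mul_self_le_mul_self_iff]
  nlinarith [Nat.zero_le (Nat.sqrt Y), Nat.zero_le c]

/-- `n^a + a + 1 ≤ (n + 2)^(a + 1)`. [folklore] -/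
theorem pow_add_le_pow (n a : ℕ) : n ^ a + a + 1 ≤ (n + 2) ^ (a + 1) := by
  induction a with
  | zero => simp
  | succ a ih =>
    rw [pow_succ (n + 2)]
    have h1 : n ^ (a + 1) = n ^ a * n := pow_succ n a
    nlinarith [Nat.zero_le (n ^ a), Nat.zero_le n]

/-- The degree hypothesis `d ≤ n^a + a` in logarithmic form: `lg (d + 1) ≤ (4a + 5) lg n`.
[folklore] -/
theorem lg_succ_le_of_le_pow {n a d : ℕ} (h : d ≤ n ^ a + a) : lg (d + 1) ≤ (4 * a + 5) * lg n := by
  have h1 : lg (d + 1) ≤ (a + 1) * lg (n + 2) + 1 :=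
    (lg_mono ((Nat.add_le_add_right h 1).trans (pow_add_le_pow n a))).trans (lg_pow_le _ _)
  have h2 : lg (n + 2) ≤ lg n + 3 := by
    have := lg_add_le n 2
    rw [lg_three] at this
    omega
  have h3 := one_le_lg n
  nlinarith

end Log

section CutArithmetic

/-- `x y + 1 ≤ (x + 1)(y + 1)`. [folklore] -/
theorem mul_succ_le_succ_mul_succ (x y : ℕ) : x * y + 1 ≤ (x + 1) * (y + 1) := by
  nlinarith [Nat.zero_le x, Nat.zero_le y]

/-- Logarithm of the wire bound of the cut circuit (`t ≤ d`):
`lg (spsBound N d s t) ≤ R (2 lg s + 4 lg(d+1) + 20) + 2t (lg(N+1) + lg(d+1) + 1) + 4 lg(d+1)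
  + lg(N+1) + 18`, `R = ⌊8d/(t+1)⌋`.
[cite: GuptaKamathKayalSaptharishi2016, Thm. 1.1 (the count `2^{O(√(d log n log s log d))}`);
Tavenas2015, Cor. 1] -/
theorem lg_spsBound_le (N d s t : ℕ) (htd : t ≤ d) :
    lg (spsBound N d s t) ≤ (8 * d / (t + 1)) * (2 * lg s + 4 * lg (d + 1) + 20) +
      2 * t * (lg (N + 1) + lg (d + 1) + 1) + 4 * lg (d + 1) + lg (N + 1) + 18 := by
  set R := 8 * d / (t + 1) with hR
  set W := 1 + 4 * R with hW
  set μ := (t + 1) * (N + t) ^ t * 2 ^ t with hμ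
  set T₀ := (d + 1) * ((4 * s * (d + 1) ^ 2) * (4 * s * (d + 1) ^ 2)) ^ R with hT₀
  set Ld := lg (d + 1) with hLd
  set LN := lg (N + 1) with hLN
  have ht1 : lg (t + 1) ≤ Ld := lg_mono (by omega)
  -- lg S ≤ ...
  have hS1 : lg (4 * s * (d + 1) ^ 2) ≤ lg s + 2 * Ld + 4 := by
    calc lg (4 * s * (d + 1) ^ 2) ≤ lg (4 * s) + lg ((d + 1) ^ 2) := lg_mul_le _ _
      _ ≤ (lg 4 + lg s) + (2 * Ld + 1) := Nat.add_le_add (lg_mul_le _ _) (lg_pow_le _ _)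
      _ = lg s + 2 * Ld + 4 := by rw [lg_four]; ring
  have hS2 : lg ((4 * s * (d + 1) ^ 2) * (4 * s * (d + 1) ^ 2)) ≤ 2 * lg s + 4 * Ld + 8 := by
    have := lg_mul_le (4 * s * (d + 1) ^ 2) (4 * s * (d + 1) ^ 2)
    omega
  have hT₀le : lg T₀ ≤ Ld + R * (2 * lg s + 4 * Ld + 8) + 1 := by
    calc lg T₀ ≤ lg (d + 1) + lg (((4 * s * (d + 1) ^ 2) * (4 * s * (d + 1) ^ 2)) ^ R) :=
          lg_mul_le _ _
      _ ≤ Ld + (R * lg ((4 * s * (d + 1) ^ 2) * (4 * s * (d + 1) ^ 2)) + 1) :=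
          Nat.add_le_add_left (lg_pow_le _ _) _
      _ ≤ Ld + (R * (2 * lg s + 4 * Ld + 8) + 1) := by gcongr
      _ = _ := by ring
  have hWle : lg (2 ^ W) = 2 + 4 * R := by rw [lg_two_pow, hW]; ring
  have hNt : lg (N + t) ≤ LN + Ld := by
    calc lg (N + t) ≤ lg ((N + 1) * (t + 1)) := lg_mono (by nlinarith)
      _ ≤ LN + lg (t + 1) := lg_mul_le _ _
      _ ≤ LN + Ld := Nat.add_le_add_left ht1 _
  have hμle : lg μ ≤ Ld + t * (LN + Ld) + t + 2 := by
    calc lg μ ≤ lg ((t + 1) * (N + t) ^ t) + lg (2 ^ t) := lg_mul_le _ _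
      _ ≤ (lg (t + 1) + lg ((N + t) ^ t)) + (t + 1) := by rw [lg_two_pow]; gcongr; exact lg_mul_le _ _
      _ ≤ (Ld + (t * lg (N + t) + 1)) + (t + 1) := by gcongr; exact lg_pow_le _ _
      _ ≤ (Ld + (t * (LN + Ld) + 1)) + (t + 1) := by gcongr
      _ = _ := by ring
  have hμ1 : lg (μ + 1) ≤ Ld + t * (LN + Ld) + t + 3 := by
    have := lg_succ_le μ; omega
  have hW1 : lg (W + 1) ≤ 4 * R + 3 := by have := lg_le_succ (W + 1); omega
  have hA : lg (μ * W + 1) ≤ (Ld + t * (LN + Ld) + t + 3) + (4 * R + 3) := by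
    calc lg (μ * W + 1) ≤ lg ((μ + 1) * (W + 1)) := lg_mono (mul_succ_le_succ_mul_succ μ W)
      _ ≤ lg (μ + 1) + lg (W + 1) := lg_mul_le _ _
      _ ≤ _ := Nat.add_le_add hμ1 hW1
  have hN3 : lg (N + 2 + 1) ≤ LN + 3 := by
    have := lg_add_le (N + 1) 2
    rw [lg_three] at this
    rw [show N + 2 + 1 = N + 1 + 2 by ring]
    omega
  have hprod4 : μ * W * t * (N + 2) + 1 ≤ (μ + 1) * (W + 1) * (t + 1) * (N + 2 + 1) := by
    calc μ * W * t * (N + 2) + 1 ≤ (μ * W * t + 1) * (N + 2 + 1) := mul_succ_le_succ_mul_succ _ _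
      _ ≤ ((μ * W + 1) * (t + 1)) * (N + 2 + 1) :=
          Nat.mul_le_mul_right _ (mul_succ_le_succ_mul_succ _ _)
      _ ≤ ((μ + 1) * (W + 1) * (t + 1)) * (N + 2 + 1) :=
          Nat.mul_le_mul_right _ (Nat.mul_le_mul_right _ (mul_succ_le_succ_mul_succ _ _))
  have hB : lg (μ * W * t * (N + 2) + 1) ≤
      (Ld + t * (LN + Ld) + t + 3) + (4 * R + 3) + Ld + (LN + 3) := by
    calc lg (μ * W * t * (N + 2) + 1) ≤ lg ((μ + 1) * (W + 1) * (t + 1) * (N + 2 + 1)) :=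
          lg_mono hprod4
      _ ≤ lg ((μ + 1) * (W + 1) * (t + 1)) + lg (N + 2 + 1) := lg_mul_le _ _
      _ ≤ (lg ((μ + 1) * (W + 1)) + lg (t + 1)) + lg (N + 2 + 1) := by
          gcongr; exact lg_mul_le _ _
      _ ≤ ((lg (μ + 1) + lg (W + 1)) + lg (t + 1)) + lg (N + 2 + 1) := by
          gcongr; exact lg_mul_le _ _
      _ ≤ ((Ld + t * (LN + Ld) + t + 3) + (4 * R + 3) + Ld) + (LN + 3) := by
          gcongr
  have htot : lg (spsBound N d s t) ≤ lg T₀ + lg (2 ^ W) + lg (μ * W + 1) +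
      lg (μ * W * t * (N + 2) + 1) := by
    unfold spsBound
    rw [← hR, ← hW, ← hμ, ← hT₀]
    calc lg (T₀ * 2 ^ W * (μ * W + 1) * (μ * W * t * (N + 2) + 1))
        ≤ lg (T₀ * 2 ^ W * (μ * W + 1)) + lg (μ * W * t * (N + 2) + 1) := lg_mul_le _ _
      _ ≤ (lg (T₀ * 2 ^ W) + lg (μ * W + 1)) + lg (μ * W * t * (N + 2) + 1) := by
          gcongr; exact lg_mul_le _ _
      _ ≤ ((lg T₀ + lg (2 ^ W)) + lg (μ * W + 1)) + lg (μ * W * t * (N + 2) + 1) := by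
          gcongr; exact lg_mul_le _ _
  rw [hWle] at htot
  linarith [htot, hT₀le, hA, hB]

/-- The constant `K = 100 a + 600` of the discharge (any larger value works; the printed
statements only assert `O(·)`). [cite: Tavenas2015, Cor. 1 (`2^{O(√(d log n log s))}`)] -/
def chasmConst (a : ℕ) : ℕ := 100 * a + 600

/-- **Regime 3 (dense: `d_f lg n ≤ lg L`)**: the plain sum of monomials is small enough.
[cite: GuptaKamathKayalSaptharishi2016, §3 (trivial ΣΠ bound); Tavenas2015, §1
("all polynomials have a formula of size `d·binom(n+d,d)`")] -/
theorem regime3_le {a n d df L s : ℕ} (hdf : 1 ≤ df) (hdfd : df ≤ d) (hda : d ≤ n ^ a + a)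
    (hLs : L ≤ s) (hR3 : df * lg n ≤ lg L) :
    2 * lg (df + 1) + df * lg (n + df) + 1 ≤
      chasmConst a * Nat.sqrt (d * lg n * lg s) + chasmConst a := by
  set CA := 4 * a + 5 with hCA
  have hLd : lg (df + 1) ≤ CA * lg n :=
    (lg_mono (Nat.succ_le_succ hdfd)).trans (lg_succ_le_of_le_pow hda)
  have hn1 : lg (n + 1) ≤ lg n + 1 := lg_succ_le n
  have hndf : lg (n + df) ≤ lg (n + 1) + lg (df + 1) := by
    calc lg (n + df) ≤ lg ((n + 1) * (df + 1)) := lg_mono (by nlinarith)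
      _ ≤ _ := lg_mul_le _ _
  have hln := one_le_lg n
  -- P = df * lg n, P² ≤ E
  have hP : (df * lg n) * (df * lg n) ≤ 1 * 1 * (d * lg n * lg s) := by
    have h1 : (df * lg n) * (df * lg n) ≤ (df * lg n) * lg L := Nat.mul_le_mul_left _ hR3
    have h2 : lg L ≤ lg s := lg_mono hLs
    calc (df * lg n) * (df * lg n) ≤ (df * lg n) * lg L := h1
      _ ≤ (d * lg n) * lg s := Nat.mul_le_mul (Nat.mul_le_mul_right _ hdfd) h2
      _ = _ := by ring
  have hP' := le_mul_sqrt_add hP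
  set sq := Nat.sqrt (d * lg n * lg s) with hsq
  have hX : 2 * lg (df + 1) + df * lg (n + df) + 1 ≤ (3 * CA + 2) * (df * lg n) + 1 := by
    have h1 : df * lg (n + df) ≤ df * ((CA + 2) * lg n) := by
      apply Nat.mul_le_mul_left
      linarith
    have h2 : CA * lg n ≤ CA * (df * lg n) :=
      Nat.mul_le_mul_left _ (Nat.le_mul_of_pos_left _ hdf)
    linarith
  calc 2 * lg (df + 1) + df * lg (n + df) + 1 ≤ (3 * CA + 2) * (df * lg n) + 1 := hX
    _ ≤ (3 * CA + 2) * (1 * sq + 1) + 1 := by gcongr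
    _ ≤ chasmConst a * sq + chasmConst a := by
        rw [chasmConst, hCA]; have := Nat.zero_le (a * sq); linarith

/-- **Regime 1 (huge degree: `(L+1)³ ≤ d_f ≤ 2^L`)**: the sum of monomials over the `≤ 2L + 1`
occurring variables has at most `(d_f + 1)^{2L+2}` wires, small enough.
[cite: GuptaKamathKayalSaptharishi2016, §3; Burgisser2000, §2.1 (degree ≤ 2^L)] -/
theorem regime1_le {a n d df L s : ℕ} (hdfd : df ≤ d) (hda : d ≤ n ^ a + a)
    (hdfL : df ≤ 2 ^ L) (hR1 : (L + 1) ^ 3 ≤ df) :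
    (2 * L + 2) * lg (df + 1) + 1 ≤
      chasmConst a * Nat.sqrt (d * lg n * lg s) + chasmConst a := by
  set CA := 4 * a + 5 with hCA
  have hLd : lg (df + 1) ≤ CA * lg n :=
    (lg_mono (Nat.succ_le_succ hdfd)).trans (lg_succ_le_of_le_pow hda)
  have hLd2 : lg (df + 1) ≤ L + 2 := by
    apply lg_le_of_le_two_pow
    have := Nat.one_le_two_pow (n := L)
    rw [pow_succ]; omega
  have hls := one_le_lg s
  have hP : ((2 * L + 2) * lg (df + 1)) * ((2 * L + 2) * lg (df + 1)) ≤
      (3 * CA) * (3 * CA) * (d * lg n * lg s) := by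
    have h1 : ((2 * L + 2) * lg (df + 1)) * ((2 * L + 2) * lg (df + 1)) ≤
        (4 * (L + 1) ^ 2 * (L + 2)) * (CA * lg n) := by
      calc ((2 * L + 2) * lg (df + 1)) * ((2 * L + 2) * lg (df + 1))
          = (4 * (L + 1) ^ 2) * (lg (df + 1) * lg (df + 1)) := by ring
        _ ≤ (4 * (L + 1) ^ 2) * ((L + 2) * (CA * lg n)) :=
            Nat.mul_le_mul_left _ (Nat.mul_le_mul hLd2 hLd)
        _ = _ := by ring
    have h2 : 4 * (L + 1) ^ 2 * (L + 2) ≤ 8 * df := by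
      calc 4 * (L + 1) ^ 2 * (L + 2) ≤ 4 * (L + 1) ^ 2 * (2 * (L + 1)) :=
            Nat.mul_le_mul_left _ (by omega)
        _ = 8 * (L + 1) ^ 3 := by ring
        _ ≤ 8 * df := Nat.mul_le_mul_left _ hR1
    calc _ ≤ (4 * (L + 1) ^ 2 * (L + 2)) * (CA * lg n) := h1
      _ ≤ (8 * df) * (CA * lg n) := Nat.mul_le_mul_right _ h2
      _ ≤ (8 * d) * (CA * lg n) * lg s := by
          calc (8 * df) * (CA * lg n) = (8 * df) * (CA * lg n) * 1 := by ring
            _ ≤ (8 * d) * (CA * lg n) * lg s := by gcongr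
      _ = (8 * CA) * (d * lg n * lg s) := by ring
      _ ≤ (3 * CA * (3 * CA)) * (d * lg n * lg s) := by
          apply Nat.mul_le_mul_right
          calc 8 * CA ≤ 8 * CA * CA := Nat.le_mul_of_pos_right _ (by omega)
            _ ≤ 9 * CA * CA := Nat.mul_le_mul_right _ (Nat.mul_le_mul_right _ (by norm_num))
            _ = 3 * CA * (3 * CA) := by ring
      _ = _ := by ring
  have hP' := le_mul_sqrt_add hP
  set sq := Nat.sqrt (d * lg n * lg s) with hsq
  calc (2 * L + 2) * lg (df + 1) + 1 ≤ 3 * CA * sq + 3 * CA + 1 := by omega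
    _ ≤ chasmConst a * sq + chasmConst a := by
        rw [chasmConst, hCA]; have := Nat.zero_le (a * sq); linarith

/-- **Regime 2 (generic)**: with the cut `t = max 1 ⌊√(d_f lg L / lg n)⌋` the wire bound of the
cut circuit is `2^{O(√(d lg n lg s))}`.
[cite: Tavenas2015, Cor. 1 (the choice of the cut); GuptaKamathKayalSaptharishi2016, Thm. 1.1] -/
theorem regime2_le {a n d df L s N t : ℕ} (hdf : 1 ≤ df) (hdfd : df ≤ d) (hda : d ≤ n ^ a + a)
    (hLs : L ≤ s) (hN : N ≤ 2 * L + 1) (hNn : N ≤ n) (hR3 : lg L < df * lg n)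
    (hR1 : df < (L + 1) ^ 3) (ht : t = max 1 (Nat.sqrt (df * lg L / lg n))) :
    1 ≤ t ∧ t ≤ df ∧ lg (spsBound N df L t) ≤
      chasmConst a * Nat.sqrt (d * lg n * lg s) + chasmConst a := by
  set CA := 4 * a + 5 with hCA
  set ℓn := lg n with hℓn
  set ℓL := lg L with hℓL
  set t₀ := Nat.sqrt (df * ℓL / ℓn) with ht₀
  set q := df * ℓL / ℓn with hq
  have hln : 1 ≤ ℓn := one_le_lg n
  have hlL : 1 ≤ ℓL := one_le_lg L
  have hq1 : t₀ * t₀ ≤ q := by rw [← pow_two]; exact Nat.sqrt_le' q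
  have hq2 : q * ℓn ≤ df * ℓL := Nat.div_mul_le_self _ _
  have hq3 : q + 1 ≤ (t₀ + 1) * (t₀ + 1) := by
    have := Nat.lt_succ_sqrt' q; rw [pow_two] at this; exact this
  have hq4 : df * ℓL < q * ℓn + ℓn := Nat.lt_div_mul_add hln
  have ht1 : 1 ≤ t := by rw [ht]; exact le_max_left _ _
  have htt₀ : t₀ ≤ t := by rw [ht]; exact le_max_right _ _
  have htle : t ≤ t₀ + 1 := by rw [ht]; exact max_le (by omega) (Nat.le_succ _)
  -- t ≤ df
  have ht₀df : t₀ ≤ df := by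
    by_contra hcon
    have hcon' : df + 1 ≤ t₀ := by omega
    have h1 : (df + 1) * (df + 1) ≤ t₀ * t₀ := Nat.mul_self_le_mul_self hcon'
    have h2 : (df + 1) * (df + 1) * ℓn ≤ df * ℓL := by
      calc (df + 1) * (df + 1) * ℓn ≤ q * ℓn := Nat.mul_le_mul_right _ (h1.trans hq1)
        _ ≤ df * ℓL := hq2
    have h3 : df * ℓL < df * (df * ℓn) := (Nat.mul_lt_mul_left hdf).2 hR3
    have h4 : df * (df * ℓn) ≤ (df + 1) * (df + 1) * ℓn := by
      calc df * (df * ℓn) = df * df * ℓn := by ring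
        _ ≤ (df + 1) * (df + 1) * ℓn := by gcongr <;> omega
    omega
  have htdf : t ≤ df := by rw [ht]; exact max_le hdf ht₀df
  refine ⟨ht1, htdf, ?_⟩
  -- logarithmic quantities
  have hLd : lg (df + 1) ≤ CA * ℓn :=
    (lg_mono (Nat.succ_le_succ hdfd)).trans (lg_succ_le_of_le_pow hda)
  have hLd7 : lg (df + 1) ≤ 7 * ℓL := by
    calc lg (df + 1) ≤ lg ((L + 1) ^ 3) := lg_mono hR1
      _ ≤ 3 * lg (L + 1) + 1 := lg_pow_le _ _
      _ ≤ 3 * (ℓL + 1) + 1 := by have := lg_succ_le L; omega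
      _ ≤ 7 * ℓL := by omega
  have hLN2 : lg (N + 1) ≤ 2 * ℓn := by
    have := lg_mono (Nat.add_le_add_right hNn 1); have := lg_succ_le n; omega
  have hLN4 : lg (N + 1) ≤ 4 * ℓL := by
    calc lg (N + 1) ≤ lg ((L + 1) * 2) := lg_mono (by omega)
      _ ≤ lg (L + 1) + lg 2 := lg_mul_le _ _
      _ ≤ (ℓL + 1) + 2 := by rw [lg_two]; have := lg_succ_le L; omega
      _ ≤ 4 * ℓL := by omega
  have hE : df * ℓn * ℓL ≤ d * ℓn * lg s :=
    Nat.mul_le_mul (Nat.mul_le_mul_right _ hdfd) (lg_mono hLs)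
  set E := d * ℓn * lg s with hEdef
  -- piece 1: R ℓL
  set R := 8 * df / (t + 1) with hR
  have hRt : R * (t + 1) ≤ 8 * df := Nat.div_mul_le_self _ _
  have hkey : df * ℓL < (t + 1) * (t + 1) * ℓn := by
    calc df * ℓL < q * ℓn + ℓn := hq4
      _ = (q + 1) * ℓn := by ring
      _ ≤ (t₀ + 1) * (t₀ + 1) * ℓn := Nat.mul_le_mul_right _ hq3
      _ ≤ (t + 1) * (t + 1) * ℓn := by gcongr
  have hP1 : (R * ℓL) * (R * ℓL) ≤ 8 * 8 * E := by
    have h1 : (R * ℓL) * (R * ℓL) * (df * ℓL) ≤ (64 * df * ℓn * ℓL) * (df * ℓL) := by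
      calc (R * ℓL) * (R * ℓL) * (df * ℓL) ≤ (R * ℓL) * (R * ℓL) * ((t + 1) * (t + 1) * ℓn) :=
            Nat.mul_le_mul_left _ hkey.le
        _ = (R * (t + 1)) * (R * (t + 1)) * ℓn * ℓL * ℓL := by ring
        _ ≤ (8 * df) * (8 * df) * ℓn * ℓL * ℓL := by gcongr
        _ = (64 * df * ℓn * ℓL) * (df * ℓL) := by ring
    have h2 : 0 < df * ℓL := Nat.mul_pos hdf hlL
    have h3 := Nat.le_of_mul_le_mul_right h1 h2
    calc (R * ℓL) * (R * ℓL) ≤ 64 * df * ℓn * ℓL := h3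
      _ = 8 * 8 * (df * ℓn * ℓL) := by ring
      _ ≤ 8 * 8 * E := Nat.mul_le_mul_left _ hE
  have hP1' := le_mul_sqrt_add hP1
  -- piece 2: t₀ ℓn
  have hP2 : (t₀ * ℓn) * (t₀ * ℓn) ≤ 1 * 1 * E := by
    calc (t₀ * ℓn) * (t₀ * ℓn) = (t₀ * t₀) * ℓn * ℓn := by ring
      _ ≤ q * ℓn * ℓn := by gcongr
      _ ≤ df * ℓL * ℓn := Nat.mul_le_mul_right _ hq2
      _ = 1 * 1 * (df * ℓn * ℓL) := by ring
      _ ≤ 1 * 1 * E := Nat.mul_le_mul_left _ hE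
  have hP2' := le_mul_sqrt_add hP2
  -- piece 3: lg (N + 1)
  have hP3 : lg (N + 1) * lg (N + 1) ≤ 3 * 3 * E := by
    calc lg (N + 1) * lg (N + 1) ≤ (2 * ℓn) * (4 * ℓL) := Nat.mul_le_mul hLN2 hLN4
      _ = 8 * (1 * ℓn * ℓL) := by ring
      _ ≤ 8 * (df * ℓn * ℓL) := by gcongr
      _ ≤ 8 * E := Nat.mul_le_mul_left _ hE
      _ ≤ 3 * 3 * E := Nat.mul_le_mul_right _ (by norm_num)
  have hP3' := le_mul_sqrt_add hP3
  -- piece 4: lg (df + 1)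
  have hP4 : lg (df + 1) * lg (df + 1) ≤ (3 * CA) * (3 * CA) * E := by
    calc lg (df + 1) * lg (df + 1) ≤ (CA * ℓn) * (7 * ℓL) := Nat.mul_le_mul hLd hLd7
      _ = 7 * CA * (1 * ℓn * ℓL) := by ring
      _ ≤ 7 * CA * (df * ℓn * ℓL) := by gcongr
      _ ≤ 7 * CA * E := Nat.mul_le_mul_left _ hE
      _ ≤ (3 * CA) * (3 * CA) * E := by
          apply Nat.mul_le_mul_right
          calc 7 * CA ≤ 7 * CA * CA := Nat.le_mul_of_pos_right _ (by omega)
            _ ≤ 9 * CA * CA := Nat.mul_le_mul_right _ (Nat.mul_le_mul_right _ (by norm_num))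
            _ = 3 * CA * (3 * CA) := by ring
  have hP4' := le_mul_sqrt_add hP4
  set sq := Nat.sqrt E with hsq
  -- the structural bound
  have hstruct := lg_spsBound_le N df L t htdf
  rw [← hR] at hstruct
  have hterm1 : R * (2 * lg L + 4 * lg (df + 1) + 20) ≤ 50 * (R * ℓL) := by
    have : 2 * lg L + 4 * lg (df + 1) + 20 ≤ 50 * ℓL := by rw [← hℓL]; omega
    calc R * (2 * lg L + 4 * lg (df + 1) + 20) ≤ R * (50 * ℓL) := Nat.mul_le_mul_left _ this
      _ = _ := by ring
  have hterm2 : 2 * t * (lg (N + 1) + lg (df + 1) + 1) ≤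
      2 * (CA + 3) * (t₀ * ℓn) + 2 * (lg (N + 1) + lg (df + 1) + 1) := by
    have h1 : 2 * t * (lg (N + 1) + lg (df + 1) + 1) ≤
        2 * (t₀ + 1) * (lg (N + 1) + lg (df + 1) + 1) := by gcongr
    have h2 : t₀ * (lg (N + 1) + lg (df + 1) + 1) ≤ (CA + 3) * (t₀ * ℓn) := by
      have : lg (N + 1) + lg (df + 1) + 1 ≤ (CA + 3) * ℓn := by linarith
      calc t₀ * (lg (N + 1) + lg (df + 1) + 1) ≤ t₀ * ((CA + 3) * ℓn) := Nat.mul_le_mul_left _ this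
        _ = _ := by ring
    calc 2 * t * (lg (N + 1) + lg (df + 1) + 1) ≤ 2 * (t₀ + 1) * (lg (N + 1) + lg (df + 1) + 1) := h1
      _ = 2 * (t₀ * (lg (N + 1) + lg (df + 1) + 1)) + 2 * (lg (N + 1) + lg (df + 1) + 1) := by ring
      _ ≤ 2 * ((CA + 3) * (t₀ * ℓn)) + 2 * (lg (N + 1) + lg (df + 1) + 1) := by gcongr
      _ = _ := by ring
  calc lg (spsBound N df L t)
      ≤ R * (2 * lg L + 4 * lg (df + 1) + 20) + 2 * t * (lg (N + 1) + lg (df + 1) + 1) +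
          4 * lg (df + 1) + lg (N + 1) + 18 := hstruct
    _ ≤ 50 * (R * ℓL) + (2 * (CA + 3) * (t₀ * ℓn) + 2 * (lg (N + 1) + lg (df + 1) + 1)) +
          4 * lg (df + 1) + lg (N + 1) + 18 :=
          Nat.add_le_add (Nat.add_le_add (Nat.add_le_add (Nat.add_le_add hterm1 hterm2) le_rfl)
            le_rfl) le_rfl
    _ = 50 * (R * ℓL) + 2 * (CA + 3) * (t₀ * ℓn) + 3 * lg (N + 1) + 6 * lg (df + 1) + 20 := by
          ring
    _ ≤ 50 * (8 * sq + 8) + 2 * (CA + 3) * (1 * sq + 1) + 3 * (3 * sq + 3) +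
          6 * (3 * CA * sq + 3 * CA) + 20 :=
          Nat.add_le_add (Nat.add_le_add (Nat.add_le_add (Nat.add_le_add
            (Nat.mul_le_mul_left _ hP1') (Nat.mul_le_mul_left _ hP2')) (Nat.mul_le_mul_left _ hP3'))
            (Nat.mul_le_mul_left _ hP4')) le_rfl
    _ ≤ chasmConst a * sq + chasmConst a := by
          rw [chasmConst, hCA]; have := Nat.zero_le (a * sq); linarith

end CutArithmetic

end Literature.Computability.AlgebraicComplexity.DepthThree

/-! ## §7 The theorem -/

namespace Literature.Computability.AlgebraicComplexity.DepthThree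

open ArithCircuit DepthReduction DepthThreeChasm

/-- From a wire bound `B` with `lg B ≤ K ⌊√E⌋ + K` to `B ≤ 2 ^ (K ⌊√E⌋ + K)`. [folklore] -/
theorem le_two_pow_of_lg_le {B X : ℕ} (h : lg B ≤ X) : B ≤ 2 ^ X :=
  (lt_two_pow_lg B).le.trans (Nat.pow_le_pow_right two_pos h)

/-- Wires of a gate-free circuit. [folklore] -/
theorem edgeSize_ofVar {k : Type*} {σ : Type*} (i : σ) : (ofVar i : ArithCircuit k σ).edgeSize = 0 :=
  rfl

/-- Wires of a gate-free circuit. [folklore] -/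
theorem edgeSize_ofConst {k : Type*} {σ : Type*} (c : k) :
    (ofConst c : ArithCircuit k σ).edgeSize = 0 :=
  rfl

/-- **The depth-three chasm with explicit constant** `K = chasmConst a = 100 a + 600`: every
`f ∈ ℂ[x₁, …, xₙ]` with `deg f ≤ d ≤ n^a + a` and fan-in-two complexity `≤ s` has a `ΣΠΣ`
circuit (product-depth `≤ 1`) with at most `2 ^ (K ⌊√(d (log₂ n + 1)(log₂ s + 1))⌋ + K)` wires.
Proof: restrict an optimal circuit to its `≤ 2L + 1` variables; in the dense regime
(`d_f lg n ≤ lg L`) and in the huge-degree regime (`(L+1)³ ≤ d_f`) the plain sum of monomials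
suffices; otherwise cut Tavenas' depth-four expansion at `t = max 1 ⌊√(d_f lg L / lg n)⌋`
and convert to depth three by Fischer's identity, Saxena's duality and univariate factoring
(`exists_sps_of_slp`). [cite: Tavenas2015, Cor. 1; GuptaKamathKayalSaptharishi2016, Thm. 1.1] -/
theorem exists_sigmaPiSigma (a n s d : ℕ) (f : MvPolynomial (Fin n) ℂ)
    (hfd : f.totalDegree ≤ d) (hda : d ≤ n ^ a + a) (hs : complexity f ≤ s) :
    ∃ P : ArithCircuit ℂ (Fin n), P.Computes f ∧ P.productDepth ≤ 1 ∧
      P.edgeSize ≤ 2 ^ (chasmConst a * Nat.sqrt (d * lg n * lg s) + chasmConst a) := by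
  classical
  set K := chasmConst a with hK
  set EX := K * Nat.sqrt (d * lg n * lg s) + K with hEX
  -- gate-free answers
  have hconst : ∀ c : ℂ, f = C c → ∃ P : ArithCircuit ℂ (Fin n), P.Computes f ∧
      P.productDepth ≤ 1 ∧ P.edgeSize ≤ 2 ^ EX := fun c hc =>
    ⟨ofConst c, by rw [Computes, eval_ofConst, hc], by rw [productDepth_ofConst]; exact Nat.zero_le _,
      by rw [edgeSize_ofConst]; exact Nat.zero_le _⟩
  have hvar : ∀ j : Fin n, f = X j → ∃ P : ArithCircuit ℂ (Fin n), P.Computes f ∧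
      P.productDepth ≤ 1 ∧ P.edgeSize ≤ 2 ^ EX := fun j hj =>
    ⟨ofVar j, by rw [Computes, eval_ofVar, hj], by rw [productDepth_ofVar]; exact Nat.zero_le _,
      by rw [edgeSize_ofVar]; exact Nat.zero_le _⟩
  set df := f.totalDegree with hdfdef
  by_cases hdf0 : df = 0
  · exact hconst (coeff 0 f) (totalDegree_eq_zero_iff_eq_C.1 hdf0)
  have hdf1 : 1 ≤ df := Nat.pos_of_ne_zero hdf0
  -- an optimal circuit, restricted to its variables
  obtain ⟨P, hP2, hPf, hPsize⟩ := exists_computes_size_eq_complexity f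
  obtain ⟨V, Q, hVcard, hQsize, hQ2imp, hPeval⟩ := DepthThreeChasm.exists_restrict P
  have hQ2 : Q.IsFanInTwo := hQ2imp hP2
  set L := complexity f with hLdef
  have hQL : Q.size = L := hQsize.trans hPsize
  have hfeq : MvPolynomial.rename Subtype.val Q.eval = f := hPeval.symm.trans hPf
  have hdf' : Q.eval.totalDegree = df := by
    rw [hdfdef, ← hfeq, totalDegree_rename_of_injective Subtype.val_injective]
  have hdfL : df ≤ 2 ^ L := by
    rw [← hdf', ← hQL]; exact totalDegree_eval_le_two_pow_size hQ2
  have hNn : Fintype.card {x // x ∈ V} ≤ n := by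
    rw [Fintype.card_coe]
    exact (Finset.card_le_univ _).trans_eq (Fintype.card_fin n)
  have hN : Fintype.card {x // x ∈ V} ≤ 2 * L + 1 := by
    rw [Fintype.card_coe, ← hPsize]
    have := edgeSize_le_two_mul_size_holds hP2
    omega
  -- renaming a circuit over the occurring variables back to `Fin n`
  have hback : ∀ C : ArithCircuit ℂ {x // x ∈ V}, C.eval = Q.eval → C.productDepth ≤ 1 →
      C.edgeSize ≤ 2 ^ EX → ∃ P : ArithCircuit ℂ (Fin n), P.Computes f ∧
        P.productDepth ≤ 1 ∧ P.edgeSize ≤ 2 ^ EX := fun C hC hpd hE =>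
    ⟨C.rename Subtype.val, by rw [Computes, eval_rename_apply, hC, hfeq],
      by rwa [productDepth_rename], by rwa [edgeSize_rename]⟩
  obtain ⟨S, hSlen, hcases⟩ := exists_slp Q hQ2
  rcases hcases with ⟨i, hi, hgi⟩ | ⟨j, hgj⟩ | ⟨c, hgc⟩
  · by_cases hR3 : df * lg n ≤ lg L
    · -- dense regime: plain sum of monomials over `Fin n`
      obtain ⟨C, hC, hpd, hE⟩ := exists_sumOfMonomials_circuit f
      refine ⟨C, hC, hpd, hE.trans (le_two_pow_of_lg_le ?_)⟩
      have hsupp : f.support.card ≤ (df + 1) * (n + df) ^ df := by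
        have := card_le_of_degree_le f.support hdf1 (fun m hm => le_totalDegree hm)
        rwa [Fintype.card_fin] at this
      calc lg (f.support.card * (df + 1)) ≤ lg (((df + 1) * (n + df) ^ df) * (df + 1)) :=
            lg_mono (Nat.mul_le_mul_right _ hsupp)
        _ ≤ lg ((df + 1) * (n + df) ^ df) + lg (df + 1) := lg_mul_le _ _
        _ ≤ (lg (df + 1) + lg ((n + df) ^ df)) + lg (df + 1) :=
            Nat.add_le_add_right (lg_mul_le _ _) _
        _ ≤ (lg (df + 1) + (df * lg (n + df) + 1)) + lg (df + 1) :=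
            Nat.add_le_add_right (Nat.add_le_add_left (lg_pow_le _ _) _) _
        _ = 2 * lg (df + 1) + df * lg (n + df) + 1 := by ring
        _ ≤ EX := regime3_le hdf1 hfd hda hs hR3
    · by_cases hR1 : (L + 1) ^ 3 ≤ df
      · -- huge-degree regime: plain sum of monomials over the occurring variables
        obtain ⟨C, hC, hpd, hE⟩ := exists_sumOfMonomials_circuit Q.eval
        refine hback C hC hpd (hE.trans (le_two_pow_of_lg_le ?_))
        have hsupp : Q.eval.support.card ≤ (df + 1) ^ (2 * L + 1) :=
          (card_support_le_pow_of_totalDegree_le hdf'.le).trans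
            (Nat.pow_le_pow_right (Nat.succ_pos _) hN)
        rw [hdf']
        calc lg (Q.eval.support.card * (df + 1)) ≤ lg ((df + 1) ^ (2 * L + 1) * (df + 1)) :=
              lg_mono (Nat.mul_le_mul_right _ hsupp)
          _ = lg ((df + 1) ^ (2 * L + 2)) := by ring_nf
          _ ≤ (2 * L + 2) * lg (df + 1) + 1 := lg_pow_le _ _
          _ ≤ EX := regime1_le hfd hda hdfL hR1
      · -- generic regime: the cut circuit
        have hR3' : lg L < df * lg n := Nat.lt_of_not_le hR3
        have hR1' : df < (L + 1) ^ 3 := Nat.lt_of_not_le hR1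
        obtain ⟨ht1, htdf, hlg⟩ := regime2_le (N := Fintype.card {x // x ∈ V}) hdf1 hfd hda hs hN
          hNn hR3' hR1' rfl
        have hdi : (S.val i).totalDegree ≤ df := by rw [← hgi, hdf']
        obtain ⟨C, hC, hpd, hE⟩ := exists_sps_of_slp S hi hdi ht1
        refine hback C (hC.trans hgi.symm) hpd (hE.trans (le_two_pow_of_lg_le ?_))
        rw [hSlen, hQL]
        exact hlg
  · refine hvar j.val ?_
    rw [← hfeq, hgj, rename_X]
  · refine hconst c ?_
    rw [← hfeq, hgc, rename_C]

end Literature.Computability.AlgebraicComplexity.DepthThree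

/-- **Discharge** of the named fact
`Literature.Computability.AlgebraicComplexity.sigmaPiSigma_edgeSize_le_of_complexity`
(the chasm at depth three: Tavenas 2015, Cor. 1, sharpening Gupta–Kamath–Kayal–Saptharishi 2016,
Thm. 1.1, in the tree's wire-counted product-depth model), with the constant
`K = 100 a + 600`. [cite: Tavenas2015, Cor. 1; GuptaKamathKayalSaptharishi2016, Thm. 1.1, §3–§5] -/
theorem Literature.Computability.AlgebraicComplexity.sigmaPiSigma_edgeSize_le_of_complexity_holds :
    Literature.Computability.AlgebraicComplexity.sigmaPiSigma_edgeSize_le_of_complexity :=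
  fun a => ⟨Literature.Computability.AlgebraicComplexity.DepthThree.chasmConst a,
    fun n s d f hfd hda hs =>
      Literature.Computability.AlgebraicComplexity.DepthThree.exists_sigmaPiSigma a n s d f hfd hda hs⟩
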